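import Mathlib.FieldTheory.IsAlgClosed.AlgebraicClosure
import Mathlib.Algebra.Field.ZMod
import Literature.Computability.AlgebraicComplexity.BorderRankMatMulSmallLMProofs
import Literature.Computability.AlgebraicComplexity.BorderRankMatMulLandsbergOttavianiAllFields
import HarnessLib

/-!
# Landsberg–Michałek 2018, Thm. 1.1 and `R̲(⟨n,n,n⟩) ≥ 2n² − ⌈log₂ n⌉ − 1` — over EVERY field

Topic `Literature/Computability/AlgebraicComplexity`. Source: J. M. Landsberg, M. Michałek,
*A `2n² − log₂(n) − 1` lower bound for the border rank of matrix multiplication*, IMRN 2018 (15)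
4722–4733 = arXiv:1608.07486, Thm. 1.1: for `0 < m < n`, `w ≥ 1`,
`R̲(M_⟨n,n,w⟩) ≥ 2nw − w + m − ⌊w·C(n−1+m, m−1)/C(2n−2, n−1)⌋`; "In particular, taking `w = n` and
`m = n − ⌈log₂(n)⌉ − 1`, `R̲(M_⟨n⟩) ≥ 2n² − ⌈log₂(n)⌉ − 1`."  LM18 work over `ℂ`.

The tree PROVES Thm. 1.1 over `ℂ` (`LandsbergMichalek2018_thm_1_1_holds`,
`BorderRankMatMulSmallLMProofs.lean`) from two ingredients that are themselves proved in greater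
generality: Part 1, border substitution with Borel/torus normalisation
(`exists_isLowerSet_algBorderRank_add_le`, `LandsbergMichalekSubstitution.lean`) over every
ALGEBRAICALLY CLOSED field `K : Type`, no hypothesis on the characteristic; Part 2, the triangular
reduced Koszul flattening of the Young-diagram-deleted tensor (`LandsbergMichalek2018_partTwo_young`,
`LandsbergMichalekKoszul.lean`) over every field.

## What is proved here (theorems only; no definitions, no named facts)

* `LandsbergMichalek2018_thm_1_1_of_isAlgClosed` — Thm. 1.1 over every algebraically closed field
  `K : Type` (the `ℂ` proof verbatim with `ℂ ↦ K`).
* **`LandsbergMichalek2018_thm_1_1_allFields`** — Thm. 1.1 over EVERY field `K : Type`: border rank can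
  only drop under extension of scalars (`algBorderRank_map_le` along `K → K̄`, BCS (15.26)), and the
  algebraic closure `K̄` is algebraically closed.
* **`LandsbergMichalek2018_borderRank_matMulTensor_allFields`** — the headline bound
  `2n² ≤ R̲(⟨n,n,n⟩_K) + ⌈log₂ n⌉ + 1` for all `n` over EVERY field (the glue
  `LandsbergMichalek2018_borderRank_matMulTensor_of_thm_1_1` verbatim, with the small cases `n ≤ 3`
  from the every-field Landsberg–Ottaviani bound `2n² ≤ R̲ + n`,
  `LandsbergOttaviani2015_algBorderRank_matMulTensor_allFields`).
* Witnesses in positive characteristic: `twentynine_le_algBorderRank_matMulTensor_four_zmod`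
  (`R̲(⟨4,4,4⟩_{𝔽_p}) ≥ 29`), `fortysix_le_algBorderRank_matMulTensor_five_zmod` (`R̲(⟨5,5,5⟩_{𝔽_p}) ≥ 46`).

RENDERING NOTE (generality): LM18 is printed over `ℂ`; the every-field statements record what the
tree's algebraic rendering of the printed proof yields (Borel fixed points over `K̄`, then descent) —
not a claim that LM18 print them. The fact `LandsbergMichalek2018_thm_1_1` (over `ℂ`) keeps its name
and its discharge; this file adds the general-field theorems next to it.

HONEST FRAMING: a known bound, kernel-checked in every characteristic; it lifts the every-field
border-rank floor of `⟨n,n,n⟩` from `2n² − n` (LO15, `BorderRankMatMulLandsbergOttavianiAllFields.lean`)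
to `2n² − ⌈log₂ n⌉ − 1`. Nothing here bears on the exponent.

## References

* [LandsbergMichalek2018] J. M. Landsberg, M. Michałek, IMRN 2018 (15) 4722–4733, Thm. 1.1 and §3.
* [BurgisserClausenShokrollahi1997] P. Bürgisser, M. Clausen, M. A. Shokrollahi, *Algebraic Complexity
  Theory*, Springer 1997, Lemma (15.26) (scalar extension).
-/

noncomputable section

open scoped BigOperators
open Module

namespace Literature.Computability.AlgebraicComplexity

/-- **Landsberg–Michałek 2018, Thm. 1.1, over every algebraically closed field `K`** (any
characteristic): for `0 < m < n`, `w ≥ 1`,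
`2nw − w + m − ⌊w·C(n−1+m,m−1)/C(2n−2,n−1)⌋ ≤ R̲(⟨n,n,w⟩_K)`. The proof of
`LandsbergMichalek2018_thm_1_1_holds` with `ℂ` replaced by `K`. [cite: LandsbergMichalek2018, Thm. 1.1] -/
theorem LandsbergMichalek2018_thm_1_1_of_isAlgClosed (K : Type) [Field K] [IsAlgClosed K]
    (n m w : ℕ) (hm : 0 < m) (hmn : m < n) (hw : 1 ≤ w) :
    ((2 * n * w - w + m : ℕ) : ℤ) -
        ((w * Nat.choose (n - 1 + m) (m - 1) / Nat.choose (2 * n - 2) (n - 1) : ℕ) : ℤ) ≤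
      (algBorderRank (matMulTensor K n n w) : ℤ) := by
  obtain ⟨p, rfl⟩ : ∃ p, n = p + 1 := ⟨n - 1, by omega⟩
  rw [algBorderRank_matMulTensor_rotate K (p + 1) (p + 1) w]
  have e1 : p + 1 - 1 + m = p + m := by omega
  have e2 : 2 * (p + 1) - 2 = 2 * p := by omega
  have e3 : p + 1 - 1 = p := by omega
  have e4 : 2 * (p + 1) * w - w + m = (2 * p + 1) * w + m := by
    rw [show 2 * (p + 1) * w = (2 * p + 1) * w + w by ring]
    omega
  rw [e1, e2, e3, e4]
  -- Part 1
  obtain ⟨D, hD, hcard, h1⟩ := exists_isLowerSet_algBorderRank_add_le (K := K) (n := p + 1) hw m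
    (by nlinarith)
  -- Part 2
  have h2 := LandsbergMichalek2018_partTwo_young K p w m D hD hcard hm (by omega)
  set B := algBorderRank (delSlices D (matMulTensor K (p + 1) w (p + 1))) with hB
  set Cc := (2 * p).choose p with hCc
  set Q := (p + m).choose (m - 1) with hQ
  have hCpos : 0 < Cc := Nat.choose_pos (by omega)
  obtain ⟨q, hq⟩ : ∃ q, w * Q / Cc = q := ⟨_, rfl⟩
  rw [hq]
  have hkey : (2 * p + 1) * w ≤ B + q := by
    rcases le_or_gt B ((2 * p + 1) * w) with hBle | hBgt
    · obtain ⟨d, hd⟩ := Nat.exists_eq_add_of_le hBle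
      have h5 : d * Cc ≤ w * Q := by
        have e5 : w * ((2 * p + 1) * Cc) = B * Cc + d * Cc := by
          rw [show w * ((2 * p + 1) * Cc) = ((2 * p + 1) * w) * Cc by ring, hd]; ring
        rw [e5] at h2
        nlinarith
      have h6 : d ≤ q := hq ▸ (Nat.le_div_iff_mul_le hCpos).2 h5
      omega
    · omega
  omega

/-- **Landsberg–Michałek 2018, Thm. 1.1, over EVERY field `K`:** the same inequality, by base change to
the algebraic closure (`R̲_{K̄} ≤ R̲_K`, `algBorderRank_map_le`). [cite: LandsbergMichalek2018, Thm. 1.1]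
[cite: BurgisserClausenShokrollahi1997, Lemma (15.26)] -/
theorem LandsbergMichalek2018_thm_1_1_allFields (K : Type) [Field K]
    (n m w : ℕ) (hm : 0 < m) (hmn : m < n) (hw : 1 ≤ w) :
    ((2 * n * w - w + m : ℕ) : ℤ) -
        ((w * Nat.choose (n - 1 + m) (m - 1) / Nat.choose (2 * n - 2) (n - 1) : ℕ) : ℤ) ≤
      (algBorderRank (matMulTensor K n n w) : ℤ) := by
  have h := LandsbergMichalek2018_thm_1_1_of_isAlgClosed (AlgebraicClosure K) n m w hm hmn hw
  have hmap : algBorderRank (matMulTensor (AlgebraicClosure K) n n w) ≤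
      algBorderRank (matMulTensor K n n w) := by
    rw [← matMulTensor_map (algebraMap K (AlgebraicClosure K)) n n w]
    exact algBorderRank_map_le _ _
  exact h.trans (by exact_mod_cast hmap)

/-- **`R̲(⟨n,n,n⟩) ≥ 2n² − ⌈log₂ n⌉ − 1` over EVERY field** (the headline bound of LM18), rendered
subtraction-free for all `n`: `2n² ≤ R̲(⟨n,n,n⟩_K) + ⌈log₂ n⌉ + 1`. For `n ≥ 4` this is Thm. 1.1 with
`w = n`, `m = n − ⌈log₂ n⌉ − 1` (where the floor term vanishes, `LandsbergMichalek2018_choose_estimate`);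
for `n ≤ 3` it is below `2n² − n` (`LandsbergOttaviani2015_algBorderRank_matMulTensor_allFields`).
[cite: LandsbergMichalek2018, Thm. 1.1] -/
theorem LandsbergMichalek2018_borderRank_matMulTensor_allFields (K : Type) [Field K] (n : ℕ) :
    2 * n ^ 2 ≤ algBorderRank (matMulTensor K n n n) + Nat.clog 2 n + 1 := by
  rcases Nat.lt_or_ge n 4 with hlt | h4
  · have hLO := LandsbergOttaviani2015_algBorderRank_matMulTensor_allFields K n
    have hcl : n ≤ Nat.clog 2 n + 1 := by
      interval_cases n
      · simp
      · simp
      · have : Nat.clog 2 2 = 1 := by decide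
        omega
      · have : Nat.clog 2 3 = 2 := by decide
        omega
    omega
  · have hn : 1 ≤ n := by omega
    -- `c = ⌈log₂ n⌉`, `n = c + 2 + j`, `m = j + 1`
    have hpow : n ≤ 2 ^ Nat.clog 2 n := Nat.le_pow_clog one_lt_two n
    have hcn : Nat.clog 2 n + 2 ≤ n := clog_two_add_two_le h4
    set c := Nat.clog 2 n with hc
    obtain ⟨j, hj⟩ : ∃ j, n = c + 2 + j := ⟨n - 2 - c, by omega⟩
    have key := LandsbergMichalek2018_choose_estimate c j
    rw [← hj] at key
    have hC' : 0 < Nat.choose (2 * c + 2 + 2 * j) (c + 1 + j) := Nat.choose_pos (by omega)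
    have hlt : n * Nat.choose (n - 1 + (j + 1)) (j + 1 - 1) <
        Nat.choose (2 * n - 2) (n - 1) := by
      have e1 : n - 1 + (j + 1) = c + 2 + 2 * j := by omega
      have e2 : j + 1 - 1 = j := by omega
      have e3 : 2 * n - 2 = 2 * c + 2 + 2 * j := by omega
      have e4 : n - 1 = c + 1 + j := by omega
      rw [e1, e2, e3, e4]
      have h1 : n * (n * Nat.choose (c + 2 + 2 * j) j) ≤
          (j + 1) * Nat.choose (2 * c + 2 + 2 * j) (c + 1 + j) :=
        calc n * (n * Nat.choose (c + 2 + 2 * j) j)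
            = n * Nat.choose (c + 2 + 2 * j) j * n := by ring
          _ ≤ n * Nat.choose (c + 2 + 2 * j) j * 2 ^ c := Nat.mul_le_mul_left _ hpow
          _ ≤ _ := key
      have h2 : (j + 1) * Nat.choose (2 * c + 2 + 2 * j) (c + 1 + j) <
          n * Nat.choose (2 * c + 2 + 2 * j) (c + 1 + j) :=
        Nat.mul_lt_mul_of_pos_right (by omega) hC'
      exact Nat.lt_of_mul_lt_mul_left (h1.trans_lt h2)
    have hdiv : n * Nat.choose (n - 1 + (j + 1)) (j + 1 - 1) / Nat.choose (2 * n - 2) (n - 1) = 0 :=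
      Nat.div_eq_of_lt hlt
    have hm := LandsbergMichalek2018_thm_1_1_allFields K n (j + 1) n (Nat.succ_pos j) (by omega) hn
    rw [hdiv] at hm
    have hm' : 2 * n * n - n + (j + 1) ≤ algBorderRank (matMulTensor K n n n) := by
      have : ((2 * n * n - n + (j + 1) : ℕ) : ℤ) ≤ (algBorderRank (matMulTensor K n n n) : ℤ) := by
        simpa using hm
      exact_mod_cast this
    have hsq : n ^ 2 = n * n := sq n
    have e2 : 2 * n * n = 2 * (n * n) := by ring
    rw [hsq]
    rw [e2] at hm'
    have hN : n ≤ n * n := Nat.le_mul_self n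
    set N := n * n with hNdef
    omega

/-- `R̲(⟨4,4,4⟩) ≥ 29` over the prime fields `𝔽_p` (`2·16 − 2 − 1`; the tree had `28` over every field,
`twentyeight_le_algBorderRank_matMulTensor_four_zmod`, and `29` over `ℂ`). For an arbitrary field use
`LandsbergMichalek2018_borderRank_matMulTensor_allFields K 4`. [cite: LandsbergMichalek2018, Thm. 1.1] -/
theorem twentynine_le_algBorderRank_matMulTensor_four_zmod (p : ℕ) [Fact p.Prime] :
    29 ≤ algBorderRank (matMulTensor (ZMod p) 4 4 4) := by
  have h := LandsbergMichalek2018_borderRank_matMulTensor_allFields (ZMod p) 4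
  have hc : Nat.clog 2 4 = 2 := by decide
  rw [hc] at h
  omega

/-- `R̲(⟨5,5,5⟩) ≥ 46` over the prime fields `𝔽_p` (`2·25 − 3 − 1`; `45` from LO15). For an arbitrary
field use `LandsbergMichalek2018_borderRank_matMulTensor_allFields K 5`. [cite: LandsbergMichalek2018, Thm. 1.1] -/
theorem fortysix_le_algBorderRank_matMulTensor_five_zmod (p : ℕ) [Fact p.Prime] :
    46 ≤ algBorderRank (matMulTensor (ZMod p) 5 5 5) := by
  have h := LandsbergMichalek2018_borderRank_matMulTensor_allFields (ZMod p) 5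
  have hc : Nat.clog 2 5 = 3 := by decide
  rw [hc] at h
  omega

end Literature.Computability.AlgebraicComplexity

end
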